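import Literature.AlgebraicGeometry.Resolution.LogRefinedChartEnvelope
import Literature.AlgebraicGeometry.Resolution.SharpMonoidEmbedding
import HarnessLib

/-!
# The refined toric charts of a log regular scheme are regular — Kato 1994, (10.3)

`Literature/AlgebraicGeometry/Resolution/LogRefinedChartRegular.lean`. Conclusion of the
`LogRefinedChart*` files (K. Kato, *Toric singularities*, Amer. J. Math. 116 (1994), (10.3):
"`(X', M')` is regular"). Let `φ : P → A` be a chart by an fs monoid `P ⊆ ℤⁿ` (`ℤP = ℤⁿ`) on a
Noetherian ring `A`, log regular at every prime (Kato (2.1)), `Q = ℕ^I ⊕ ℤ^{Iᶜ} ⊇ P` the dual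
monoid of a regular cone inside `P^∨` (in a `ℤ`-basis of `ℤⁿ`), and `C` an `A`-algebra GENERATED
by a monoid homomorphism `χ : Q → C` extending `φ` and admitting `A`-maps into every field in
which `φ(P)` is invertible (e.g. the affine chart `A[χ(Q)] ⊆ A[φ(m)⁻¹]` of the toric
modification). THEN EVERY LOCAL RING `C_𝔓` IS A REGULAR LOCAL RING
(`isRegularLocalRing_localization_chartAlgebra`): the map `Λ : K♯_𝔔 → C_𝔓` from the refined
chart ring of `LogRegularRefinementChart` (regular by
`LogRegularCompleteStructure.isRegularLocalRing_localization_closedPoint_of_le`) is surjective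
(`Lam_surjective`), and injective because `Ω ∘ Λ` is the embedding of `K♯_𝔔` into its fraction
field for the map `Ω : C_𝔓 → Frac K♯_𝔔` built from the group envelope (`Omega_comp_Lam`).

References: [Kato1994] K. Kato, Toric singularities, Amer. J. Math. 116 (1994), (10.3), (10.4).
-/

noncomputable section

open IsLocalRing Literature.RingTheory.MvPowerSeries

namespace Literature.AlgebraicGeometry.Resolution

namespace LogRefinedChart

open LogRegularCompleteStructure

universe u

variable {n : ℕ} {A : Type u} [CommRing A] {P : AddSubmonoid (Fin n → ℤ)}
  {φ : Multiplicative P →* A} {C : Type u} [CommRing C] [Algebra A C]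
  {Q : AddSubmonoid (Fin n → ℤ)} {b : Module.Basis (Fin n) ℤ (Fin n → ℤ)} {I : Finset (Fin n)}
  {hQ : IsOrthantLike b I Q} {χ : Multiplicative Q →* C} {𝔓 : Ideal C} [𝔓.IsPrime]
  {π₀ : (Fin n → ℤ) →ₗ[ℤ] (Fin n → ℤ)} {e : (Fin n → ℤ) →+ (Fin n → ℤ)}
  {he : LogChart.IsSharpEmbedding P (LogChart.faceMonoid P φ (𝔓.comap (algebraMap A C))) e}
  (ℌ : Hyps P φ Q χ 𝔓 π₀) (𝒟 : PointData hQ χ 𝔓 π₀ he) [IsNoetherianRing A]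
  (ω : C →+* Frac ℌ 𝒟) (hω : ω.comp (algebraMap A C) = gA ℌ 𝒟)

/-! ### `ω` on the unit parts -/

omit [IsNoetherianRing A] in
/-- `x − σ x` is the `U`-part `Σ_{i ∈ U} xᵢ bᵢ` of `x`. [cite: Kato1994, (10.3)] -/
theorem sub_sigma_eq_sum (x : Fin n → ℤ) :
    x - sigma hQ χ 𝔓 x = ∑ i ∈ (unitIdx hQ χ 𝔓).attach, b.repr x i • b (i : Fin n) := by
  apply b.repr.injective
  ext j
  rw [map_sub, Finsupp.sub_apply, repr_sigma]
  simp only [map_sum, map_zsmul, Module.Basis.repr_self, Finsupp.coe_finsetSum, Finset.sum_apply,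
    Finsupp.smul_apply, Finsupp.single_apply, smul_eq_mul, mul_ite, mul_one, mul_zero]
  split_ifs with hj
  · rw [sub_zero, Finset.sum_eq_single ⟨j, hj⟩]
    · simp
    · rintro ⟨i, hi⟩ _ hne
      rw [if_neg]
      exact fun h => hne (Subtype.ext h)
    · intro h; exact absurd (Finset.mem_attach _ _) h
  · rw [sub_self, eq_comm]
    refine Finset.sum_eq_zero fun i _ => ?_
    rw [if_neg]
    rintro rfl
    exact hj i.2

include hω in
/-- **`ω` on unit parts**: under any extension `ω′` of `ω` to `C_𝔓`, the unit part of `x` goes to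
`Θ(x − σ x)`. Stated for `Units.map` of a ring map `Ω` with `Ω ∘ (C → C_𝔓) = ω`.
[cite: Kato1994, (10.3)] -/
theorem units_map_unitPartAt (Ω : Localization.AtPrime 𝔓 →+* Frac ℌ 𝒟)
    (hΩ : Ω.comp (algebraMap C (Localization.AtPrime 𝔓)) = ω) (x : Fin n → ℤ) :
    Units.map (Ω : Localization.AtPrime 𝔓 →* Frac ℌ 𝒟) (Additive.toMul (unitPartAt hQ χ 𝔓 x)) =
      Additive.toMul (envelope ℌ 𝒟 (x - sigma hQ χ 𝔓 x)) := by
  have hgen : ∀ i : ↥(unitIdx hQ χ 𝔓), Units.map (Ω : Localization.AtPrime 𝔓 →* Frac ℌ 𝒟)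
      (isUnit_of_mem_unitIdx hQ χ 𝔓 i i.2).unit = Additive.toMul (envelope ℌ 𝒟 (b i)) := by
    intro i
    ext
    rw [Units.coe_map, MonoidHom.coe_coe, IsUnit.unit_spec, chiLoc_apply, ← RingHom.comp_apply, hΩ,
      omega_chi ℌ 𝒟 ω hω (hQ.basis_mem i)]
  rw [sub_sigma_eq_sum, map_sum]
  show Units.map _ (Additive.toMul (∑ i ∈ (unitIdx hQ χ 𝔓).attach,
    (b.repr x i) • Additive.ofMul (isUnit_of_mem_unitIdx hQ χ 𝔓 i i.2).unit)) = _
  simp only [toMul_sum, map_prod, toMul_zsmul, toMul_ofMul, map_zpow, hgen, map_zsmul]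

/-! ### Lifting units and generators through `Λ` -/

/-- Reindexing products over the non-unit indices. [cite: Kato1994, (10.3)] -/
theorem prod_nonUnitIdx {M : Type*} [CommMonoid M] (f : Fin n → M) :
    ∏ j, f (nonUnitIdx hQ χ 𝔓 j) = ∏ i ∈ (unitIdx hQ χ 𝔓)ᶜ, f i := by
  rw [← Finset.prod_attach (unitIdx hQ χ 𝔓)ᶜ]
  exact Fintype.prod_equiv (nonUnitEquiv hQ χ 𝔓).symm _ _ fun j => rfl

omit [IsNoetherianRing A] in
/-- `Σⱼ b*_{i_j}(x) b_{i_j} = σ x`. [cite: Kato1994, (10.3)] -/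
theorem sum_repr_nonUnitIdx_smul (x : Fin n → ℤ) :
    ∑ j, b.repr x (nonUnitIdx hQ χ 𝔓 j) • b (nonUnitIdx hQ χ 𝔓 j) = sigma hQ χ 𝔓 x := by
  have h1 : ∑ j, b.repr x (nonUnitIdx hQ χ 𝔓 j) • b (nonUnitIdx hQ χ 𝔓 j) =
      ∑ i ∈ (unitIdx hQ χ 𝔓)ᶜ, b.repr x i • b i := by
    rw [← Finset.sum_attach (unitIdx hQ χ 𝔓)ᶜ]
    exact Fintype.sum_equiv (nonUnitEquiv hQ χ 𝔓).symm _ _ fun j => rfl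
  rw [h1, sigma, LinearMap.coe_sum, Finset.sum_apply]
  rfl

set_option maxHeartbeats 800000 in
/-- **Unit lifting**: for `x ∈ H_U` there is a unit `κ` of `K♯_𝔔` with `Λ(κ) =` the unit part of
`x` and `κ = Θ(x)` in `L` (`κ = X^{b′(x)} · φ(f⁺)/φ(f⁻)` for `x − π₀ x = f⁺ − f⁻`).
[cite: Kato1994, (10.3)] -/
theorem exists_unit_lift {x : Fin n → ℤ} (hx : x ∈ hsub hQ χ 𝔓) :
    ∃ κ : (KL ℌ 𝒟)ˣ, LamH ℌ 𝒟 κ = ((Additive.toMul (unitPartAt hQ χ 𝔓 x) :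
        (Localization.AtPrime 𝔓)ˣ) : Localization.AtPrime 𝔓) ∧
      iotaL ℌ 𝒟 κ = ((Additive.toMul (envelope ℌ 𝒟 x) : (Frac ℌ 𝒟)ˣ) : Frac ℌ 𝒟) := by
  obtain ⟨f₁, hf₁, f₂, hf₂, h12⟩ := (LogChart.mem_span_int_iff_exists_sub _).1 (ℌ.sub_proj x)
  -- the face units in `A_𝔭`
  have hu₁ := LogChart.isUnit_algebraMap_val P φ (𝔓.comap (algebraMap A C)) hf₁
  have hu₂ := LogChart.isUnit_algebraMap_val P φ (𝔓.comap (algebraMap A C)) hf₂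
  set w : (BaseLoc A 𝔓)ˣ := hu₁.unit * hu₂.unit⁻¹ with hw
  have hw₂ : (w : BaseLoc A 𝔓) * algebraMap A (BaseLoc A 𝔓) (LogChart.val P φ f₂) =
      algebraMap A (BaseLoc A 𝔓) (LogChart.val P φ f₁) := by
    rw [hw, Units.val_mul, mul_assoc, Units.inv_mul_of_eq hu₂.unit_spec, mul_one]
    exact hu₁.unit_spec
  set κ₁ : (KL ℌ 𝒟)ˣ := Units.map (toK ℌ 𝒟 : TorusLoc A hQ χ 𝔓 π₀ →* KL ℌ 𝒟)
    (Additive.toMul (torusMonomial A hQ χ 𝔓 π₀ x)) with hκ₁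
  set κ₂ : (KL ℌ 𝒟)ˣ :=
    Units.map ((toK ℌ 𝒟).comp (baseMap A hQ χ 𝔓 π₀) : BaseLoc A 𝔓 →* KL ℌ 𝒟) w with hκ₂
  have hκ₁v : (κ₁ : KL ℌ 𝒟) = toK ℌ 𝒟 (Additive.toMul (torusMonomial A hQ χ 𝔓 π₀ x) :
      (TorusLoc A hQ χ 𝔓 π₀)ˣ) := by rw [hκ₁, Units.coe_map, MonoidHom.coe_coe]
  have hκ₂v : (κ₂ : KL ℌ 𝒟) = toK ℌ 𝒟 (baseMap A hQ χ 𝔓 π₀ (w : BaseLoc A 𝔓)) := by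
    rw [hκ₂, Units.coe_map, MonoidHom.coe_coe, RingHom.comp_apply]
  have hσ : sigma hQ χ 𝔓 x = 0 := sigma_eq_zero_of_repr hQ χ 𝔓 fun i hi => hx i hi
  have hxs : π₀ x + (f₁ - f₂) = x := by rw [← h12]; abel
  refine ⟨κ₁ * κ₂, ?_, ?_⟩
  · -- `Λ`-side
    have h1 : LamH ℌ 𝒟 (κ₁ : KL ℌ 𝒟) = ((Additive.toMul (unitPartAt hQ χ 𝔓 (π₀ x)) :
        (Localization.AtPrime 𝔓)ˣ) : Localization.AtPrime 𝔓) := by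
      rw [hκ₁v, Lam_toK, rho_torusMonomial, hσ, sub_zero]
    have hval : ∀ {f : Fin n → ℤ}, f ∈ LogChart.faceMonoid P φ (𝔓.comap (algebraMap A C)) →
        LamH ℌ 𝒟 (toK ℌ 𝒟 (baseMap A hQ χ 𝔓 π₀
          (algebraMap A (BaseLoc A 𝔓) (LogChart.val P φ f)))) =
        ((Additive.toMul (unitPartAt hQ χ 𝔓 f) : (Localization.AtPrime 𝔓)ˣ) :
          Localization.AtPrime 𝔓) := by
      intro f hf
      rw [Lam_toK, rho_baseMap, rho₀_algebraMap, chiLoc_eq_unitPartAt_of_mem_faceMonoid hQ χ 𝔓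
        ℌ.le ℌ.chi hf]
    have h2 : LamH ℌ 𝒟 (κ₂ : KL ℌ 𝒟) = ((Additive.toMul (unitPartAt hQ χ 𝔓 (f₁ - f₂)) :
        (Localization.AtPrime 𝔓)ˣ) : Localization.AtPrime 𝔓) := by
      have e1 : LamH ℌ 𝒟 (κ₂ : KL ℌ 𝒟) *
          ((Additive.toMul (unitPartAt hQ χ 𝔓 f₂) : (Localization.AtPrime 𝔓)ˣ) :
            Localization.AtPrime 𝔓) =
          ((Additive.toMul (unitPartAt hQ χ 𝔓 f₁) : (Localization.AtPrime 𝔓)ˣ) :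
            Localization.AtPrime 𝔓) := by
        rw [hκ₂v, ← hval hf₂, ← map_mul, ← map_mul, ← map_mul, hw₂, hval hf₁]
      rw [map_sub, toMul_sub, div_eq_mul_inv, Units.val_mul]
      exact (Units.eq_mul_inv_iff_mul_eq _).2 e1
    rw [Units.val_mul, map_mul, h1, h2, ← Units.val_mul, ← toMul_add, ← map_add, hxs]
  · -- `L`-side
    have h1 : iotaL ℌ 𝒟 (κ₁ : KL ℌ 𝒟) =
        ((Additive.toMul (envelope ℌ 𝒟 (π₀ x)) : (Frac ℌ 𝒟)ˣ) : Frac ℌ 𝒟) := by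
      rw [hκ₁v, ← toL_apply, ← MonoidHom.coe_coe (toL ℌ 𝒟), ← Units.coe_map,
        units_map_toL_torusMonomial]
      congr 1
      have hπx : π₀ x = ∑ k, torusCoord hQ χ 𝔓 π₀ x k •
          ((torusBasis hQ χ 𝔓 π₀ k : torusLattice hQ χ 𝔓 π₀) : Fin n → ℤ) := by
        rw [sum_torusCoord_smul, hσ, sub_zero]
      rw [hπx, map_sum (envelope ℌ 𝒟)]
      simp only [map_zsmul, toMul_sum, toMul_zsmul, toMul_ofMul, XL_eq]
    have hval : ∀ {f : Fin n → ℤ}, f ∈ LogChart.faceMonoid P φ (𝔓.comap (algebraMap A C)) →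
        iotaL ℌ 𝒟 (toK ℌ 𝒟 (baseMap A hQ χ 𝔓 π₀
          (algebraMap A (BaseLoc A 𝔓) (LogChart.val P φ f)))) =
        ((Additive.toMul (envelope ℌ 𝒟 f) : (Frac ℌ 𝒟)ˣ) : Frac ℌ 𝒟) := by
      intro f hf
      have e0 : iotaL ℌ 𝒟 (toK ℌ 𝒟 (baseMap A hQ χ 𝔓 π₀
          (algebraMap A (BaseLoc A 𝔓) (LogChart.val P φ f)))) = gA ℌ 𝒟 (LogChart.val P φ f) := rfl
      rw [e0, LogChart.val_of_mem P φ hf.1, coe_envelope_of_mem ℌ 𝒟 hf.1]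
    have h2 : iotaL ℌ 𝒟 (κ₂ : KL ℌ 𝒟) =
        ((Additive.toMul (envelope ℌ 𝒟 (f₁ - f₂)) : (Frac ℌ 𝒟)ˣ) : Frac ℌ 𝒟) := by
      have e1 : iotaL ℌ 𝒟 (κ₂ : KL ℌ 𝒟) *
          ((Additive.toMul (envelope ℌ 𝒟 f₂) : (Frac ℌ 𝒟)ˣ) : Frac ℌ 𝒟) =
          ((Additive.toMul (envelope ℌ 𝒟 f₁) : (Frac ℌ 𝒟)ˣ) : Frac ℌ 𝒟) := by
        rw [hκ₂v, ← hval hf₂, ← map_mul, ← map_mul, ← map_mul, hw₂, hval hf₁]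
      rw [map_sub, toMul_sub, div_eq_mul_inv, Units.val_mul]
      exact (Units.eq_mul_inv_iff_mul_eq _).2 e1
    rw [Units.val_mul, map_mul, h1, h2, ← Units.val_mul, ← toMul_add, ← map_add, hxs]

set_option maxHeartbeats 800000 in
include hω in
/-- **Generator lifting**: for `q ∈ Q`, `κ = T^{b*(q)} · κ_{q − σ q}` satisfies `Λ(κ) = χ(q)` and
`κ = ω(χ(q))` in `L`. [cite: Kato1994, (10.3)] -/
theorem exists_lift_chi {q : Fin n → ℤ} (hq : q ∈ Q) :
    ∃ κ : KL ℌ 𝒟, LamH ℌ 𝒟 κ = algebraMap C (Localization.AtPrime 𝔓) (χ (Multiplicative.ofAdd ⟨q, hq⟩)) ∧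
      iotaL ℌ 𝒟 κ = ω (χ (Multiplicative.ofAdd ⟨q, hq⟩)) := by
  have hnn : ∀ j : Fin (refineRank hQ χ 𝔓), 0 ≤ b.repr q (nonUnitIdx hQ χ 𝔓 j) := fun j =>
    (hQ.mem_iff q).1 hq _ (mem_of_not_mem_unitIdx hQ χ 𝔓 (nonUnitIdx_not_mem hQ χ 𝔓 j))
  obtain ⟨κu, hΛu, hιu⟩ := exists_unit_lift ℌ 𝒟 (sub_sigma_mem_hsub hQ χ 𝔓 q)
  refine ⟨(∏ j, Tvar ℌ 𝒟 j ^ (b.repr q (nonUnitIdx hQ χ 𝔓 j)).toNat) * κu, ?_, ?_⟩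
  · rw [map_mul, hΛu, map_prod, ← chiLoc_apply, chiLoc_eq_prod_mul_unitPartAt hQ χ 𝔓 q hq,
      map_sub, unitPartAt_sigma, sub_zero]
    congr 1
    simp only [map_pow, Lam_Tvar]
    exact prod_nonUnitIdx (fun i => chiLoc χ 𝔓 (Multiplicative.ofAdd ⟨b i, hQ.basis_mem i⟩) ^
      (b.repr q i).toNat)
  · rw [map_mul, hιu, map_prod, omega_chi ℌ 𝒟 ω hω hq]
    simp only [map_pow]
    -- `∏ Tⱼ^{qⱼ} = Θ(σ q)` in `L`
    have h1 : ∏ j, iotaL ℌ 𝒟 (Tvar ℌ 𝒟 j) ^ (b.repr q (nonUnitIdx hQ χ 𝔓 j)).toNat =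
        ((Additive.toMul (envelope ℌ 𝒟 (sigma hQ χ 𝔓 q)) : (Frac ℌ 𝒟)ˣ) : Frac ℌ 𝒟) := by
      rw [← sum_repr_nonUnitIdx_smul, map_sum, toMul_sum, Units.coe_prod]
      refine Finset.prod_congr rfl fun j _ => ?_
      rw [← coe_TL, TL_eq, map_zsmul, toMul_zsmul, ← zpow_natCast, Units.val_zpow_eq_zpow_val,
        Int.toNat_of_nonneg (hnn j)]
    rw [h1, ← Units.val_mul, ← toMul_add, ← map_add, add_sub_cancel]

include hω in
/-- **Lifting**: every element of `C = A[χ(Q)]` is `Λ(κ)` for some `κ ∈ K♯_𝔔` with `κ = ω(c)` in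
`L`. [cite: Kato1994, (10.3)] -/
theorem exists_lift (hgen : Algebra.adjoin A (Set.range χ) = ⊤) (c : C) :
    ∃ κ : KL ℌ 𝒟, LamH ℌ 𝒟 κ = algebraMap C (Localization.AtPrime 𝔓) c ∧
      iotaL ℌ 𝒟 κ = ω c := by
  have hc : c ∈ Algebra.adjoin A (Set.range χ) := by rw [hgen]; exact Algebra.mem_top
  induction hc using Algebra.adjoin_induction with
  | mem x hx =>
    obtain ⟨q, rfl⟩ := hx
    have : q = Multiplicative.ofAdd ⟨(q.toAdd : Fin n → ℤ), q.toAdd.2⟩ := rfl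
    rw [this]
    exact exists_lift_chi ℌ 𝒟 ω hω q.toAdd.2
  | algebraMap a =>
    refine ⟨toK ℌ 𝒟 (baseMap A hQ χ 𝔓 π₀ (algebraMap A (BaseLoc A 𝔓) a)), ?_, ?_⟩
    · rw [Lam_toK, rho_baseMap, rho₀_algebraMap, IsScalarTower.algebraMap_apply A C]
    · exact (DFunLike.congr_fun hω a).symm
  | add x y _ _ hx hy =>
    obtain ⟨κ, h1, h2⟩ := hx
    obtain ⟨κ', h1', h2'⟩ := hy
    exact ⟨κ + κ', by rw [map_add, h1, h1', map_add], by rw [map_add, h2, h2', map_add]⟩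
  | mul x y _ _ hx hy =>
    obtain ⟨κ, h1, h2⟩ := hx
    obtain ⟨κ', h1', h2'⟩ := hy
    exact ⟨κ * κ', by rw [map_mul, h1, h1', map_mul], by rw [map_mul, h2, h2', map_mul]⟩

/-! ### `Λ` is bijective -/

include hω in
/-- **`Λ` is surjective.** [cite: Kato1994, (10.3)] -/
theorem Lam_surjective (hgen : Algebra.adjoin A (Set.range χ) = ⊤) :
    Function.Surjective (LamH ℌ 𝒟) := by
  intro r
  obtain ⟨⟨c, s⟩, hcs⟩ := IsLocalization.surj 𝔓.primeCompl r
  obtain ⟨κ, hκ, -⟩ := exists_lift ℌ 𝒟 ω hω hgen c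
  obtain ⟨κs, hκs, -⟩ := exists_lift ℌ 𝒟 ω hω hgen (s : C)
  have hsu : IsUnit (algebraMap C (Localization.AtPrime 𝔓) (s : C)) := IsLocalization.map_units _ s
  have hκsu : IsUnit κs := by
    rw [← isUnit_map_iff (LamH ℌ 𝒟), hκs]; exact hsu
  refine ⟨κ * ↑hκsu.unit⁻¹, ?_⟩
  have hr : r = algebraMap C (Localization.AtPrime 𝔓) c * ↑hsu.unit⁻¹ := by
    rw [← hcs, mul_assoc, IsUnit.mul_val_inv, mul_one]
  rw [hr, map_mul, hκ]
  congr 1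
  symm
  apply Units.inv_eq_of_mul_eq_one_right
  rw [IsUnit.unit_spec, ← hκs, ← map_mul, IsUnit.mul_val_inv, map_one]

include hω in
/-- Elements of `C ∖ 𝔓` go to units of `L` under `ω`. [cite: Kato1994, (10.3)] -/
theorem isUnit_omega (hgen : Algebra.adjoin A (Set.range χ) = ⊤) (s : 𝔓.primeCompl) :
    IsUnit (ω (s : C)) := by
  obtain ⟨κs, hκs, hωs⟩ := exists_lift ℌ 𝒟 ω hω hgen (s : C)
  have hκsu : IsUnit κs := by
    rw [← isUnit_map_iff (LamH ℌ 𝒟), hκs]; exact IsLocalization.map_units _ s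
  rw [← hωs]
  exact hκsu.map _

/-- **`Ω : C_𝔓 → L`**, the extension of `ω`. [cite: Kato1994, (10.3)] -/
def Omega (hgen : Algebra.adjoin A (Set.range χ) = ⊤) : Localization.AtPrime 𝔓 →+* Frac ℌ 𝒟 :=
  IsLocalization.lift (M := 𝔓.primeCompl) (S := Localization.AtPrime 𝔓) (g := ω)
    (isUnit_omega ℌ 𝒟 ω hω hgen)

/-- `Ω` extends `ω`. [cite: Kato1994, (10.3)] -/
theorem Omega_algebraMap (hgen : Algebra.adjoin A (Set.range χ) = ⊤) (c : C) :
    Omega ℌ 𝒟 ω hω hgen (algebraMap C (Localization.AtPrime 𝔓) c) = ω c :=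
  IsLocalization.lift_eq _ c

/-- `Ω ∘ ρ₀ = gBase` on `A_𝔭`. [cite: Kato1994, (10.3)] -/
theorem Omega_comp_rho₀ (hgen : Algebra.adjoin A (Set.range χ) = ⊤) :
    (Omega ℌ 𝒟 ω hω hgen).comp (rho₀ A 𝔓) = gBase ℌ 𝒟 := by
  refine IsLocalization.ringHom_ext (𝔓.comap (algebraMap A C)).primeCompl ?_
  ext a
  rw [RingHom.comp_apply, RingHom.comp_apply, rho₀_algebraMap, Omega_algebraMap,
    ← RingHom.comp_apply, hω]
  rfl

/-- `Ω ∘ ρ = toL` on `A₁`. [cite: Kato1994, (10.3)] -/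
theorem Omega_comp_rho (hgen : Algebra.adjoin A (Set.range χ) = ⊤) :
    (Omega ℌ 𝒟 ω hω hgen).comp (rho A hQ χ 𝔓 π₀) = toL ℌ 𝒟 := by
  refine IsLocalization.ringHom_ext (torusPrime A hQ χ 𝔓 π₀).primeCompl ?_
  refine MvPolynomial.ringHom_ext (fun x => ?_) (fun k => ?_)
  · rw [RingHom.comp_apply, RingHom.comp_apply, rho_algebraMap, evalHom_C, ← RingHom.comp_apply,
      Omega_comp_rho₀, RingHom.comp_apply, ← MvPolynomial.algebraMap_eq,
      ← IsScalarTower.algebraMap_apply]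
    rfl
  · rw [RingHom.comp_apply, RingHom.comp_apply, rho_algebraMap, evalHom_X, RingHom.comp_apply,
      ← coe_xUnit, ← coe_XL, XL_eq, ← MonoidHom.coe_coe (Omega ℌ 𝒟 ω hω hgen), ← Units.coe_map,
      units_map_unitPartAt ℌ 𝒟 ω hω _ (by ext c; exact Omega_algebraMap ℌ 𝒟 ω hω hgen c),
      sigma_eq_zero_of_repr hQ χ 𝔓 (fun i hi => torusLattice_le_hsub hQ χ 𝔓 ℌ.le ℌ.chi π₀ ℌ.sub_proj
        (torusBasis hQ χ 𝔓 π₀ k).2 i hi), sub_zero]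

/-- **`Ω ∘ Λ` is the embedding `K♯_𝔔 ↪ L`.** [cite: Kato1994, (10.3)] -/
theorem Omega_comp_Lam (hgen : Algebra.adjoin A (Set.range χ) = ⊤) :
    (Omega ℌ 𝒟 ω hω hgen).comp (LamH ℌ 𝒟) = iotaL ℌ 𝒟 := by
  refine IsLocalization.ringHom_ext (KPoint ℌ.le ℌ.chi ℌ.proj_zero 𝒟).primeCompl ?_
  refine Ideal.Quotient.ringHom_ext ?_
  refine MvPolynomial.ringHom_ext (fun a => ?_) (fun i => ?_)
  · simp only [RingHom.comp_apply]
    rw [LamH, Lam_C, ← RingHom.comp_apply, Omega_comp_rho, toL_apply]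
    rfl
  · simp only [RingHom.comp_apply]
    induction i using Fin.addCases with
    | left j =>
      rw [LamH, Lam_X, tvec, Fin.append_left, chiLoc_apply, Omega_algebraMap,
        omega_chi ℌ 𝒟 ω hω (hQ.basis_mem _), ← TL_eq, coe_TL]
      rfl
    | right k =>
      have h1 : algebraMap (KRing 𝒟) (KL ℌ 𝒟) (Ideal.Quotient.mk _ (MvPolynomial.X (Fin.natAdd _ k))) =
          toK ℌ 𝒟 (params 𝒟 k) := (toK_params ℌ 𝒟 k).symm
      rw [h1, Lam_toK, ← RingHom.comp_apply, Omega_comp_rho, toL_apply]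

include hω in
/-- **`Λ` is injective.** [cite: Kato1994, (10.3)] -/
theorem Lam_injective (hgen : Algebra.adjoin A (Set.range χ) = ⊤) : Function.Injective (LamH ℌ 𝒟) := by
  intro x y hxy
  apply iotaL_injective ℌ 𝒟
  rw [← Omega_comp_Lam ℌ 𝒟 ω hω hgen, RingHom.comp_apply, RingHom.comp_apply, hxy]

include hω in
/-- **`Λ : K♯_𝔔 ≅ C_𝔓`.** [cite: Kato1994, (10.3)] -/
theorem Lam_bijective (hgen : Algebra.adjoin A (Set.range χ) = ⊤) : Function.Bijective (LamH ℌ 𝒟) :=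
  ⟨Lam_injective ℌ 𝒟 ω hω hgen, Lam_surjective ℌ 𝒟 ω hω hgen⟩

set_option maxHeartbeats 800000 in
include hω in
/-- **`C_𝔓 ≅ K♯_𝔔` is a regular local ring.** [cite: Kato1994, (10.3)] -/
theorem isRegularLocalRing_of_hyps (hgen : Algebra.adjoin A (Set.range χ) = ⊤) :
    IsRegularLocalRing (Localization.AtPrime 𝔓) :=
  IsRegularLocalRing.of_ringEquiv (R := KL ℌ 𝒟)
    (RingEquiv.ofBijective (LamH ℌ 𝒟) (Lam_bijective ℌ 𝒟 ω hω hgen))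

/-! ### The theorem -/

omit ℌ 𝒟 ω hω

/-- **Kato 1994, (10.3): the refined toric charts of a log regular scheme are regular.** Let `A` be
a Noetherian ring with a chart `φ : P → A` by a finitely generated, saturated, spanning
`P ⊆ ℤⁿ`, log regular at every prime (Kato (2.1)); let `Q = ℕ^I ⊕ ℤ^{Iᶜ} ⊇ P` in a `ℤ`-basis
of `ℤⁿ` and `C` an `A`-algebra generated by a monoid homomorphism `χ : Q → C` extending `φ`, such
that every `A`-map into a field making `φ(P)` invertible extends to `C` (e.g. `C = A[χ(Q)]`
inside a localization of `A` at a chart element). Then all local rings of `C` are regular.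
[cite: Kato1994, (10.3)] -/
theorem isRegularLocalRing_localization_chartAlgebra {A : Type u} [CommRing A] [IsNoetherianRing A]
    {n : ℕ} {P : AddSubmonoid (Fin n → ℤ)} (hP : P.FG)
    (hsat : ∀ (v : Fin n → ℤ) (k : ℕ), 0 < k → k • v ∈ P → v ∈ P)
    (hspan : Submodule.span ℤ (P : Set (Fin n → ℤ)) = ⊤) {φ : Multiplicative P →* A}
    (hreg : ∀ (𝔭 : Ideal A) [𝔭.IsPrime], LogChart.IsLogRegularAt P φ 𝔭)
    {C : Type u} [CommRing C] [Algebra A C] {Q : AddSubmonoid (Fin n → ℤ)}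
    {b : Module.Basis (Fin n) ℤ (Fin n → ℤ)} {I : Finset (Fin n)} (hQ : IsOrthantLike b I Q)
    (hPQ : P ≤ Q) (χ : Multiplicative Q →* C)
    (hχ : ∀ p : P, χ (Multiplicative.ofAdd ⟨(p : Fin n → ℤ), hPQ p.2⟩) =
      algebraMap A C (φ (Multiplicative.ofAdd p)))
    (hgen : Algebra.adjoin A (Set.range χ) = ⊤)
    (hΩ : ∀ (L : Type u) [Field L] (g : A →+* L), (∀ p : P, g (φ (Multiplicative.ofAdd p)) ≠ 0) →
      ∃ ω : C →+* L, ω.comp (algebraMap A C) = g)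
    (𝔓 : Ideal C) [𝔓.IsPrime] : IsRegularLocalRing (Localization.AtPrime 𝔓) := by
  have hface := LogChart.isFaceOf_faceMonoid P φ (𝔓.comap (algebraMap A C))
  obtain ⟨e, he⟩ := LogChart.exists_isSharpEmbedding hP hface hsat
  obtain ⟨π₀, hπ₀0, hπ₀1, hπ₀2⟩ := hface.exists_proj hsat
  have ℌ : Hyps P φ Q χ 𝔓 π₀ := ⟨hPQ, hχ, hπ₀0, hπ₀1, hπ₀2, hspan, hP⟩
  obtain ⟨𝒟⟩ := nonempty_pointData hQ χ 𝔓 hPQ hχ π₀ hπ₀0 hπ₀1 he hP (hreg _)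
  obtain ⟨ω, hω⟩ := hΩ (Frac ℌ 𝒟) (gA ℌ 𝒟) (gA_phi_ne_zero ℌ 𝒟)
  exact isRegularLocalRing_of_hyps ℌ 𝒟 ω hω hgen

end LogRefinedChart

end Literature.AlgebraicGeometry.Resolution
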